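import Summits.BirchSwinnertonDyer.Rank1Residual.X2.SplitSwitchDisplayKit
import HarnessLib

/-!
# Row B11 ∩ SPLIT at ANY odd `p ≥ 3` — the étale-switch display kit WITH THE VALUE HALF AS A TYPED INPUT
# (for `p = 3`, where no printed value theorem exists): `BSD(E,p)` on a whole `ℚ`-isogeny class from one
# étale `p`-step or a two-step chain (cell `bsd-eis`, seat `bsd-eis-cgshw` g9; route `EisensteinPrimes`,
# crux 4 `BSDpOnCellC` = stmt-BirchSwinnertonDyer-19034, line b1 skeleton v7, stubs `stub_c2` (p = 3) /
# `stub_ctlOrSwitch`; companion of `X2/SplitSwitchDisplayKit.lean` p443992; THEOREMS ONLY)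

HONEST FRAMING (cell `bsd-eis`, run/shared/lean/pub/bsd-eis/): theorems only; nothing booked; X2 stays
CONSTRUCTION-SHAPED; no label or count moves. `X2/SplitSwitchDisplayKit.lean` serves `p ≥ 5`, where the
value half c2s is PUBLISHED (cas-split). At `p = 3` — 12 106 of the 12 665 B11 cells, among them the 37
window classes that referee g25 found reachable only by a two-step étale CHAIN — the value half
`SplitBDPValueOnTreeInt W p` is a TYPED input (LZZ18 Thms. 3.8/3.10 LEAD modulo (N1)–(N3); skeleton v7
`stub_c2`). This file gives the same two kit theorems with that input explicit and `3 ≤ p`: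

* `bsdp_of_isIsogenous_of_etaleStep_of_value_of_mazurMC` — one étale step `φ : W₀ → W₁`;
* `bsdp_of_isIsogenous_of_etaleChain2_of_value_of_mazurMC` — two étale steps `W₀ → W₁ → W₂`;
both from PUB (incl. Hsieh 2014 Thm. 1, Ogg–Saito, DD15/Stevens) + [typed] c2s♭ and [PRE] c3s♭ at the
étale end + crux 3 ∩ split at the partner + [per class] `r_an = 1` at the étale end and
`HasPrimeToManinDatum` at the source; the Galois side off the isogeny; CTL-split the THEOREM at the
torsion-free étale end (`p443992`'s road with `bsdp_of_cellC_of_split_of_manin_of_intResiduals`, p432213,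
in place of the `p ≥ 5` pointwise theorem). CONDITIONAL on every listed binder; nothing booked.

References: [DokchitserDokchitser2015LocalInvariants] Prop. 4.10, Thm. A.1; [Stevens1989Invent] (2.2);
[Hsieh2014] Thm. 1; [KellerYin2024] Thm. 5.1.3 (PRE); [LiuZhangZhang2018] Thms. 3.8/3.10 (lead only);
[CastellaEtAl2021] Thm. 5.3.1; [SilvermanATAEC1994] IV.10–11; [MilneADT2006] I.7.3; [Miller2011LMS] Def. 1.1.
-/

set_option autoImplicit false

noncomputable section

open scoped Classical MatrixGroups ModularForm

open CongruenceSubgroup WeierstrassCurve NumberField IsDedekindDomain Field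
  Literature.NumberTheory.EllipticCurves Literature.NumberTheory.EllipticCurves.GreenbergSelmer
  Literature.NumberTheory.EllipticCurves.ModularForms Literature.NumberTheory.QuadraticFields
  Literature.NumberTheory.EllipticCurves.Rank1Residual
  Literature.NumberTheory.EllipticCurves.Rank1Residual.Typed
  Literature.NumberTheory.EllipticCurves.KrizLi2019
  Literature.NumberTheory.EllipticCurves.GreenbergVatsal2000
  Literature.NumberTheory.EllipticCurves.Wuthrich2014
  Literature.NumberTheory.EllipticCurves.SteinWuthrich2013
  Literature.NumberTheory.GaloisRepresentations Literature.NumberTheory.GaloisCohomology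
  Literature.NumberTheory.Automorphic
  Summit.BirchSwinnertonDyer.Rank1Residual.X11b.AcSelmer
  Summit.BirchSwinnertonDyer.Rank1Residual.X11b.Halves
  Summit.BirchSwinnertonDyer.Rank1Residual.X11b
  Summit.BirchSwinnertonDyer.Rank1Residual

namespace Summit.BirchSwinnertonDyer.Rank1Residual.X2

section OneStep

variable {W₀ W₁ : WeierstrassCurve ℚ} [W₀.IsElliptic] [W₀.IsGloballyMinimal] [W₁.IsElliptic]
  [W₁.IsGloballyMinimal] {p : ℕ} [Fact p.Prime]

/-- **KIT at any odd `p ≥ 3`, value half TYPED: `BSD(W, p)` for every curve of the class from ONE étale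
`p`-step out of the curve carrying the Manin datum.** Data: `φ : W₀ → W₁` of degree `p`, `W₀`
multiplicative and `W₁` SPLIT at `p`, `v_p j(W₀) = p·v_p j(W₁)`, `p ∤ v_p Δ_min(W₁)`. Inputs: [PUB] the
named facts (`hGV … hHL`, the five cohomological facts, Edixhoven/Mazur/Cassels not needed here,
Ogg–Saito `hOS`, DD15/Stevens `hDS`); [typed] `h2 : SplitBDPValueOnTreeInt W₁ p` (c2s♭; at `p = 3` no
printed source); [PRE] `h3 : SplitIMCEqOnTreeInt W₁ p`; crux 3 ∩ split `hMCB`; [per class]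
`hr : r_an(W₁) = 1`, `hMan₀ : HasPrimeToManinDatum W₀ p`. Road: Galois side off `φ`; Manin along `φ`;
CTL the THEOREM at `W₁`; `bsdp_of_cellC_of_split_of_manin_of_intResiduals` (p432213); Cassels.
CONDITIONAL on the listed binders; nothing booked. [cite: DokchitserDokchitser2015LocalInvariants, Prop. 4.10 (p. 4348) and Thm. A.1 (p. 4354)]
[cite: Stevens1989Invent, §2 Lemma (2.2)] [cite: Hsieh2014, Thm. 1 (arXiv:1112.1580 pp. 3–4)]
[claim: KellerYin2024, status: under-review] [cite: CastellaEtAl2021, Thm. 5.3.1] [cite: MilneADT2006, Thm. I.7.3]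
[cite: Miller2011LMS, Def. 1.1] -/
theorem bsdp_of_isIsogenous_of_etaleStep_of_value_of_mazurMC
    (hGV : lambdaMu_multiplicative_of_gvPar) (hWu : thm16_charIdeal_dvd_multiplicative_of_reducible)
    (hJs : thm61_splitMultiplicative) (hJn : thm61_nonsplitMultiplicative)
    (hHs : exists_isSplitMultCanonical) (hHn : exists_isMultCanonical)
    (hpar : nonempty_modularParametrizationData)
    (hGS : ∀ (W : WeierstrassCurve ℚ) [W.IsElliptic] [W.IsGloballyMinimal] (p : ℕ) [Fact p.Prime],
      greenberg_stevens (W := W) (p := p))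
    (hnf : exists_isNewformOf)
    (hPT : ∀ (K : Type) [Field K] [NumberField K], poitouTate_selmerStructure_duality K)
    (hPT2 : ∀ (K : Type) [Field K] [NumberField K], poitouTate_sha_tateDual K)
    (hEP : ∀ (K : Type) [Field K] [NumberField K] (v : HeightOneSpectrum (𝓞 K)),
      localEulerPoincareCharacteristic (v.adicCompletion K))
    (hcd : fieldCdLE_two_of_numberField)
    (hBr : ∀ (K : Type) [Field K] [NumberField K] (p : ℕ) [Fact p.Prime],
      ZpExtension.decomp_not_le_kerSubgroup_of_isAnticyclotomic K p)
    (hH : hsieh2014_exists_anticyclotomicPAdicLFunction)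
    (hGZ : ∀ (N : ℕ) [NeZero N] (W : WeierstrassCurve ℚ) (K : Type) [Field K] [NumberField K],
      gross_zagier N W K)
    (hKo : ∀ (N : ℕ) [NeZero N] (W : WeierstrassCurve ℚ) (K : Type) [Field K] [NumberField K],
      kolyvagin N W K)
    (hHP : ∀ (N : ℕ) [NeZero N] (W : WeierstrassCurve ℚ) (K : Type) [Field K] [NumberField K],
      heegnerPointComplex_mem_range_map N W K)
    (hGZK : rank_eq_analyticRank_of_analyticRank_le_one) (hHL : HoffsteinLuo1997_exists_twist_L_one_ne_zero)
    (hCassels : bsdRHS_eq_of_isIsogenous)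
    (hOS : ∀ (W : WeierstrassCurve ℚ) (ℓ : ℕ) [Fact ℓ.Prime],
      W.artinConductorExponent_tate_eq_conductorExponent_of_isElliptic ℓ)
    (hDS : dokchitserStevens_maninDatum_of_pIsogeny)
    (hp3 : 3 ≤ p) (φ : Isogeny W₀ W₁) (hdeg : φ.degree = p)
    (hmult₀ : W₀.HasMultiplicativeReductionAtPrime p) (hs₁ : W₁.HasSplitMultiplicativeReductionAtPrime p)
    (hj : padicValRat p W₀.j = p * padicValRat p W₁.j)
    (hv : ¬ p ∣ padicValInt p W₁.minimalDiscriminantInt)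
    (hMCB : ∀ (W' : WeierstrassCurve ℚ) [W'.IsElliptic] [W'.IsGloballyMinimal],
      CellB W' p → W'.HasSplitMultiplicativeReductionAtPrime p → MazurMainConjectureAt W' p)
    (hr : W₁.analyticRank = 1) (hMan₀ : HasPrimeToManinDatum W₀ p)
    (h2 : SplitBDPValueOnTreeInt W₁ p) (h3 : SplitIMCEqOnTreeInt W₁ p)
    (W : WeierstrassCurve ℚ) [W.IsElliptic] [W.IsGloballyMinimal] (hW : IsIsogenous W W₀) : BSDp W p := by
  have hp : p.Prime := Fact.out
  have hp2 : p ≠ 2 := by omega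
  have hmod : hasEntireLFunction_rat := hasEntireLFunction_rat_of_exists_isNewformOf hnf
  have hiso : IsIsogenous W₀ W₁ := ⟨φ⟩
  have hred₁ : ¬ W₁.HasIrreducibleModPGaloisRep p :=
    not_hasIrreducibleModPGaloisRep_of_isIsogenous hiso
      (not_hasIrreducibleModPGaloisRep_of_isogeny_degree_eq φ hdeg)
  have hc₁ : CellC W₁ p := ⟨hr, hp2, hred₁, hs₁.hasMultiplicativeReductionAtPrime⟩
  have hMan₁ : HasPrimeToManinDatum W₁ p :=
    hasPrimeToManinDatum_of_pIsogeny hDS hMan₀ φ hdeg hmult₀ hj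
      (conductorNorm_eq_of_isIsogenous_of_tate hOS W₀ W₁ hiso).symm
  have h0 : ∀ Q₀ : (W₁.baseChange ℚ_[p]).toAffine.Point, p • Q₀ = 0 → Q₀ = 0 :=
    X11b.LocalTorsion.localTorsion_eq_zero_of_mult W₁ p hp3 hc₁.2.2.2 (Or.inr hv)
  have hCTL₁ : SplitControlOnTree W₁ p :=
    splitControlOnTree_of_cellC_of_noPadicPTorsion W₁ p hGZK hnf hPT hPT2 hEP hcd hBr hc₁ h0
  have hb₁ : BSDp W₁ p :=
    bsdp_of_cellC_of_split_of_manin_of_intResiduals W₁ p hGV hWu hJs hJn hHs hHn hpar hGS hnf hH hGZ hKo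
      hHP hGZK hHL hc₁ hs₁ hMan₁ h2 h3 hCTL₁ hMCB
  exact bsdp_of_isIsogenous_of_bsdp hCassels hGZK hmod W₁ W (hW.trans' hiso).symm_of_charZero p
    (by rw [hc₁.1]) hb₁

end OneStep

section TwoStep

variable {W₀ W₁ W₂ : WeierstrassCurve ℚ} [W₀.IsElliptic] [W₀.IsGloballyMinimal] [W₁.IsElliptic]
  [W₁.IsGloballyMinimal] [W₂.IsElliptic] [W₂.IsGloballyMinimal] {p : ℕ} [Fact p.Prime]

/-- **KIT at any odd `p ≥ 3`, value half TYPED, two-step étale chain `W₀ → W₁ → W₂`** — the intended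
client is a referee-g25 chain-only window class @3 once its value input is available (typed today).
CONDITIONAL on the listed binders; nothing booked. [cite: DokchitserDokchitser2015LocalInvariants, Prop. 4.10 (p. 4348) and Thm. A.1 (p. 4354)]
[cite: Stevens1989Invent, §2 Lemma (2.2)] [cite: SilvermanAEC2009, IX.6 Example 6.4]
[claim: KellerYin2024, status: under-review] [cite: MilneADT2006, Thm. I.7.3] [cite: Miller2011LMS, Def. 1.1] -/
theorem bsdp_of_isIsogenous_of_etaleChain2_of_value_of_mazurMC
    (hGV : lambdaMu_multiplicative_of_gvPar) (hWu : thm16_charIdeal_dvd_multiplicative_of_reducible)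
    (hJs : thm61_splitMultiplicative) (hJn : thm61_nonsplitMultiplicative)
    (hHs : exists_isSplitMultCanonical) (hHn : exists_isMultCanonical)
    (hpar : nonempty_modularParametrizationData)
    (hGS : ∀ (W : WeierstrassCurve ℚ) [W.IsElliptic] [W.IsGloballyMinimal] (p : ℕ) [Fact p.Prime],
      greenberg_stevens (W := W) (p := p))
    (hnf : exists_isNewformOf)
    (hPT : ∀ (K : Type) [Field K] [NumberField K], poitouTate_selmerStructure_duality K)
    (hPT2 : ∀ (K : Type) [Field K] [NumberField K], poitouTate_sha_tateDual K)
    (hEP : ∀ (K : Type) [Field K] [NumberField K] (v : HeightOneSpectrum (𝓞 K)),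
      localEulerPoincareCharacteristic (v.adicCompletion K))
    (hcd : fieldCdLE_two_of_numberField)
    (hBr : ∀ (K : Type) [Field K] [NumberField K] (p : ℕ) [Fact p.Prime],
      ZpExtension.decomp_not_le_kerSubgroup_of_isAnticyclotomic K p)
    (hH : hsieh2014_exists_anticyclotomicPAdicLFunction)
    (hGZ : ∀ (N : ℕ) [NeZero N] (W : WeierstrassCurve ℚ) (K : Type) [Field K] [NumberField K],
      gross_zagier N W K)
    (hKo : ∀ (N : ℕ) [NeZero N] (W : WeierstrassCurve ℚ) (K : Type) [Field K] [NumberField K],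
      kolyvagin N W K)
    (hHP : ∀ (N : ℕ) [NeZero N] (W : WeierstrassCurve ℚ) (K : Type) [Field K] [NumberField K],
      heegnerPointComplex_mem_range_map N W K)
    (hGZK : rank_eq_analyticRank_of_analyticRank_le_one) (hHL : HoffsteinLuo1997_exists_twist_L_one_ne_zero)
    (hCassels : bsdRHS_eq_of_isIsogenous)
    (hOS : ∀ (W : WeierstrassCurve ℚ) (ℓ : ℕ) [Fact ℓ.Prime],
      W.artinConductorExponent_tate_eq_conductorExponent_of_isElliptic ℓ)
    (hDS : dokchitserStevens_maninDatum_of_pIsogeny)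
    (hp3 : 3 ≤ p) (φ₁ : Isogeny W₀ W₁) (φ₂ : Isogeny W₁ W₂) (hdeg₁ : φ₁.degree = p) (hdeg₂ : φ₂.degree = p)
    (hmult₀ : W₀.HasMultiplicativeReductionAtPrime p) (hmult₁ : W₁.HasMultiplicativeReductionAtPrime p)
    (hs₂ : W₂.HasSplitMultiplicativeReductionAtPrime p)
    (hj₁ : padicValRat p W₀.j = p * padicValRat p W₁.j) (hj₂ : padicValRat p W₁.j = p * padicValRat p W₂.j)
    (hv : ¬ p ∣ padicValInt p W₂.minimalDiscriminantInt)
    (hMCB : ∀ (W' : WeierstrassCurve ℚ) [W'.IsElliptic] [W'.IsGloballyMinimal],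
      CellB W' p → W'.HasSplitMultiplicativeReductionAtPrime p → MazurMainConjectureAt W' p)
    (hr : W₂.analyticRank = 1) (hMan₀ : HasPrimeToManinDatum W₀ p)
    (h2 : SplitBDPValueOnTreeInt W₂ p) (h3 : SplitIMCEqOnTreeInt W₂ p)
    (W : WeierstrassCurve ℚ) [W.IsElliptic] [W.IsGloballyMinimal] (hW : IsIsogenous W W₀) : BSDp W p := by
  have hp : p.Prime := Fact.out
  have hp2 : p ≠ 2 := by omega
  have hmod : hasEntireLFunction_rat := hasEntireLFunction_rat_of_exists_isNewformOf hnf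
  have h01 : IsIsogenous W₀ W₁ := ⟨φ₁⟩
  have h12 : IsIsogenous W₁ W₂ := ⟨φ₂⟩
  have hiso : IsIsogenous W₀ W₂ := h01.trans' h12
  have hred₂ : ¬ W₂.HasIrreducibleModPGaloisRep p :=
    not_hasIrreducibleModPGaloisRep_of_isIsogenous h12
      (not_hasIrreducibleModPGaloisRep_of_isogeny_degree_eq φ₂ hdeg₂)
  have hc₂ : CellC W₂ p := ⟨hr, hp2, hred₂, hs₂.hasMultiplicativeReductionAtPrime⟩
  have hMan₂ : HasPrimeToManinDatum W₂ p :=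
    hasPrimeToManinDatum_of_pIsogeny_chain2 hDS hMan₀ φ₁ φ₂ hdeg₁ hdeg₂ hmult₀ hmult₁ hj₁ hj₂
      (conductorNorm_eq_of_isIsogenous_of_tate hOS W₀ W₁ h01).symm
      (conductorNorm_eq_of_isIsogenous_of_tate hOS W₁ W₂ h12).symm
  have h0 : ∀ Q₀ : (W₂.baseChange ℚ_[p]).toAffine.Point, p • Q₀ = 0 → Q₀ = 0 :=
    X11b.LocalTorsion.localTorsion_eq_zero_of_mult W₂ p hp3 hc₂.2.2.2 (Or.inr hv)
  have hCTL₂ : SplitControlOnTree W₂ p :=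
    splitControlOnTree_of_cellC_of_noPadicPTorsion W₂ p hGZK hnf hPT hPT2 hEP hcd hBr hc₂ h0
  have hb₂ : BSDp W₂ p :=
    bsdp_of_cellC_of_split_of_manin_of_intResiduals W₂ p hGV hWu hJs hJn hHs hHn hpar hGS hnf hH hGZ hKo
      hHP hGZK hHL hc₂ hs₂ hMan₂ h2 h3 hCTL₂ hMCB
  exact bsdp_of_isIsogenous_of_bsdp hCassels hGZK hmod W₂ W (hW.trans' hiso).symm_of_charZero p
    (by rw [hc₂.1]) hb₂

end TwoStep

end Summit.BirchSwinnertonDyer.Rank1Residual.X2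

end
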